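import Summits.Ventures.PackingBounds.Configurations.LeechCard4600
import Summits.Ventures.PackingBounds.Configurations.LeechSectionCount
import Summits.Ventures.PackingBounds.Configurations.LeechSectionShapes

/-!
# Coordinate sections of the Leech minimal vectors, V: a balanced triple — `A(18, arccos 1/3) ≥ 704`

Framing: lottery ticket; floor = certified bounds/negative ranges. Venture `PackingBounds` (cell `pub-packcert`, seat
`pub-packcert-sdp`), ATTAINED side of the B2c cell `(18, 1/3)` (part I: `640`; upper side Levenshtein-tight `1303`,
`SphericalCodes.code_dim18_third_le_1303`). `ST(J₀)` = Leech minimal vectors (`√8`-scaling) with `y₀ = y₁ = 2`,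
**`y₂ + y₃ + y₄ = 0`**, `y_j = 0 (j ∈ J₀ ⊆ {5,…,23})`: shape `B` only; an octad through `0, 1` avoiding `J₀` gives `32`
vectors if it avoids `T = {2,3,4}`, `16` if `|o ∩ T| = 2` (opposite signs at the two coordinates, which always sit at the
octad POSITIONS `2, 3` by the rank lemma `opos_symm_val_eq_card`: position = number of octad coordinates below), none if
`|o ∩ T| ∈ {1, 3}`: **`|ST(J₀)| = 32·K₀ + 16·K₂`**; coordinates `0, 1` deleted ⇒ norm `24`, pairwise `ip ≤ 8` (cos `≤ 1/3`),
orthogonal to `e₀, e₁, e₂+e₃+e₄, e_j (j ∈ J₀)` ⇒ dimension `21 - |J₀|` (`exists_code_third_triple_of_octads`). Exhaustive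
search (`work/explore/triplesec.py`): optima `1088, 832, 704, 704, 464, 320, 224, 224, 128` for `|J₀| = 0..8`; dim `18`
beats parts I/III: `J₀ = {13,15,20}` (`{0,…,4} ∪ J₀` an octad), `K₀ = 16`, `K₂ = 12` ⇒ **`A(18, arccos 1/3) ≥ 704`**
(bracket `[704, 1303]`; binary codes `A₂(18,6) ≤ 680`; nothing in print, SPLAG Table 9.2 stops at `n = 10`). Reference:
Conway–Sloane, *Sphere Packings, Lattices and Groups*, 3rd ed., Ch. 4 §11 (135), Ch. 10 §2, Ch. 14 Thm 1. [`ConwaySloane1999`]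
-/

namespace Summit.Ventures.PackingBounds.Config.Leech.PrefixThirdTriple

open Finset Golay Summit.Ventures.PackingBounds.Config.Leech

/-- Rank of an octad coordinate: the position of `j ∈ o` is the number of octad coordinates below `j`. -/
theorem opos_symm_val_eq_card (o : Fin 759) (j : Fin 24) (hj : j ∈ osupp o) :
    ((opos o).symm ⟨j, hj⟩).val = ((osupp o).filter fun x => x < j).card := by
  set r := (opos o).symm ⟨j, hj⟩ with hr
  have hjr : ((opos o r : osupp o) : Fin 24) = j := by
    have := OrderIso.apply_symm_apply (opos o) ⟨j, hj⟩
    rw [← hr] at this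
    exact congrArg (fun z : osupp o => (z : Fin 24)) this
  have key : (osupp o).filter (fun x => x < j) = (Finset.Iio r).image (fun r' => ((opos o r' : osupp o) : Fin 24)) := by
    ext x
    simp only [Finset.mem_filter, Finset.mem_image, Finset.mem_Iio]
    constructor
    · rintro ⟨hx, hxj⟩
      refine ⟨(opos o).symm ⟨x, hx⟩, ?_, ?_⟩
      · have : (opos o) ((opos o).symm ⟨x, hx⟩) < (opos o) r := by
          rw [OrderIso.apply_symm_apply]
          rw [← Subtype.coe_lt_coe, hjr]
          exact hxj
        exact (opos o).lt_iff_lt.mp this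
      · have := OrderIso.apply_symm_apply (opos o) ⟨x, hx⟩
        exact congrArg (fun z : osupp o => (z : Fin 24)) this
    · rintro ⟨r', hr', rfl⟩
      refine ⟨(opos o r').2, ?_⟩
      rw [← hjr]
      exact Subtype.coe_lt_coe.mpr ((opos o).strictMono hr')
  rw [key, Finset.card_image_of_injective _ (fun a b hab => (opos o).injective (Subtype.ext hab)), Fin.card_Iio]

/-- Shape-`B` value at an octad coordinate of rank `< 7`: the sign bit is bit `rank` of `v`. -/
theorem bvec_apply_of_rank (o : Fin 759) (v : ℕ) (j : Fin 24) (hj : j ∈ osupp o) {ρ : ℕ}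
    (hρ : ((osupp o).filter fun x => x < j).card = ρ) (h7 : ρ < 7) : bvec o v j = 2 * sgn (v.testBit ρ) := by
  have hr := opos_symm_val_eq_card o j hj
  rw [hρ] at hr
  simp only [bvec, dif_pos hj, bbit, hr, h7, if_true]

/-- The section `ST(J₀)`: minimal vectors with `y₀ = y₁ = 2`, `y₂ + y₃ + y₄ = 0`, vanishing on `J₀`. -/
noncomputable def sec (J0 : Finset (Fin 24)) : Finset (Fin 24 → ℤ) :=
  leechInt.filter fun y => ((y 0 = 2 ∧ y 1 = 2) ∧ y 2 + y 3 + y 4 = 0) ∧ ∀ j ∈ J0, y j = 0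

/-- Members of `ST(J₀)`. -/
theorem mem_sec {J0 : Finset (Fin 24)} {y : Fin 24 → ℤ} (hy : y ∈ sec J0) :
    y ∈ leechInt ∧ ((y 0 = 2 ∧ y 1 = 2) ∧ y 2 + y 3 + y 4 = 0) ∧ ∀ j ∈ J0, y j = 0 := by
  simpa [sec] using hy

/-- Shape `A`: no vector satisfies the condition. -/
theorem card_A (J0 : Finset (Fin 24)) :
    (idxA.filter fun p => (((avec p.1.1 p.1.2 p.2.1 p.2.2) 0 = 2 ∧ (avec p.1.1 p.1.2 p.2.1 p.2.2) 1 = 2) ∧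
      (avec p.1.1 p.1.2 p.2.1 p.2.2) 2 + (avec p.1.1 p.1.2 p.2.1 p.2.2) 3 + (avec p.1.1 p.1.2 p.2.1 p.2.2) 4 = 0) ∧
      ∀ j ∈ J0, (avec p.1.1 p.1.2 p.2.1 p.2.2) j = 0).card = 0 := by
  rw [Finset.card_eq_zero, Finset.filter_eq_empty_iff]
  rintro p - ⟨⟨⟨h0, -⟩, -⟩, -⟩   -- entries of a shape-`A` vector are `0, ±4, ±8`, never `2`
  revert h0; unfold avec
  rcases sgn_cases p.2.1 with ha | ha <;> rcases sgn_cases p.2.2 with hb | hb <;> rw [ha, hb] <;> split_ifs <;> omega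

/-- Shape `C`: no vector satisfies the condition. -/
theorem card_C (J0 : Finset (Fin 24)) :
    ((univ ×ˢ range 4096).filter fun p : Fin 24 × ℕ =>
      ((((cvec p.1 p.2) 0 = 2 ∧ (cvec p.1 p.2) 1 = 2) ∧ (cvec p.1 p.2) 2 + (cvec p.1 p.2) 3 + (cvec p.1 p.2) 4 = 0) ∧
        ∀ j ∈ J0, (cvec p.1 p.2) j = 0)).card = 0 := by
  rw [Finset.card_eq_zero, Finset.filter_eq_empty_iff]
  rintro p - ⟨⟨⟨h0, -⟩, -⟩, -⟩   -- entries of a shape-`C` vector are odd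
  rcases cvec_apply_cases p.1 p.2 0 with ⟨_, h | h⟩ | ⟨_, h | h⟩ <;> omega

/-- The octad meets `{2, 3, 4}` in exactly two coordinates. -/
def twoOfT (o : Fin 759) : Prop :=
  ((2 : Fin 24) ∈ osupp o ∧ (3 : Fin 24) ∈ osupp o ∧ (4 : Fin 24) ∉ osupp o) ∨
  ((2 : Fin 24) ∈ osupp o ∧ (3 : Fin 24) ∉ osupp o ∧ (4 : Fin 24) ∈ osupp o) ∨
  ((2 : Fin 24) ∉ osupp o ∧ (3 : Fin 24) ∈ osupp o ∧ (4 : Fin 24) ∈ osupp o)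

/-- `twoOfT` is decidable (a Boolean combination of octad memberships). -/
instance (o : Fin 759) : Decidable (twoOfT o) := by unfold twoOfT; infer_instance

/-- `twoOfT` is incompatible with avoiding `2`… `4` entirely. -/
theorem twoOfT_not_avoid (o : Fin 759) (ht : twoOfT o)
    (h : (2 : Fin 24) ∉ osupp o ∧ (3 : Fin 24) ∉ osupp o ∧ (4 : Fin 24) ∉ osupp o) : False := by
  rcases ht with ⟨h2, -, -⟩ | ⟨h2, -, -⟩ | ⟨-, h3, -⟩ <;> simp_all

/-- The octad coordinates below `j`, as a filter of the coordinates `< j`. -/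
theorem filter_lt_eq (o : Fin 759) (j : Fin 24) :
    (osupp o).filter (fun x => x < j) = (univ.filter fun x : Fin 24 => x < j).filter (fun x => x ∈ osupp o) := by
  ext x; simp [and_comm]

/-- Rank of `2` in an octad through `0, 1, 2`: `2`. -/
theorem rank2 (o : Fin 759) (h0 : (0 : Fin 24) ∈ osupp o) (h1 : (1 : Fin 24) ∈ osupp o) :
    ((osupp o).filter fun x => x < (2 : Fin 24)).card = 2 := by
  rw [filter_lt_eq, show (univ.filter fun x : Fin 24 => x < (2 : Fin 24)) = {0, 1} from by decide]
  simp [Finset.filter_insert, Finset.filter_singleton, h0, h1]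

/-- Rank of `3` in an octad through `0, 1, 2, 3`: `3`. -/
theorem rank3_of_mem2 (o : Fin 759) (h0 : (0 : Fin 24) ∈ osupp o) (h1 : (1 : Fin 24) ∈ osupp o)
    (h2 : (2 : Fin 24) ∈ osupp o) : ((osupp o).filter fun x => x < (3 : Fin 24)).card = 3 := by
  rw [filter_lt_eq, show (univ.filter fun x : Fin 24 => x < (3 : Fin 24)) = {0, 1, 2} from by decide]
  simp [Finset.filter_insert, Finset.filter_singleton, h0, h1, h2]

/-- Rank of `3` in an octad through `0, 1` avoiding `2`: `2`. -/
theorem rank3_of_not2 (o : Fin 759) (h0 : (0 : Fin 24) ∈ osupp o) (h1 : (1 : Fin 24) ∈ osupp o)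
    (h2 : (2 : Fin 24) ∉ osupp o) : ((osupp o).filter fun x => x < (3 : Fin 24)).card = 2 := by
  rw [filter_lt_eq, show (univ.filter fun x : Fin 24 => x < (3 : Fin 24)) = {0, 1, 2} from by decide]
  simp [Finset.filter_insert, Finset.filter_singleton, h0, h1, h2]

/-- Rank of `4` in an octad through `0, 1` containing exactly one of `2, 3`: `3`. -/
theorem rank4 (o : Fin 759) (h0 : (0 : Fin 24) ∈ osupp o) (h1 : (1 : Fin 24) ∈ osupp o)
    (h23 : ((2 : Fin 24) ∈ osupp o ∧ (3 : Fin 24) ∉ osupp o) ∨ ((2 : Fin 24) ∉ osupp o ∧ (3 : Fin 24) ∈ osupp o)) :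
    ((osupp o).filter fun x => x < (4 : Fin 24)).card = 3 := by
  rw [filter_lt_eq, show (univ.filter fun x : Fin 24 => x < (4 : Fin 24)) = {0, 1, 2, 3} from by decide]
  rcases h23 with ⟨h2, h3⟩ | ⟨h2, h3⟩ <;> simp [Finset.filter_insert, Finset.filter_singleton, h0, h1, h2, h3]

/-- On an octad through `0, 1` meeting `{2, 3, 4}` in exactly two coordinates, `y₂ + y₃ + y₄ = 0` says the sign bits `2, 3`
differ. -/
theorem sum_iff_of_twoOfT (o : Fin 759) (v : ℕ) (h0 : (0 : Fin 24) ∈ osupp o) (h1 : (1 : Fin 24) ∈ osupp o)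
    (ht : twoOfT o) : bvec o v 2 + bvec o v 3 + bvec o v 4 = 0 ↔ v.testBit 2 ≠ v.testBit 3 := by
  rcases ht with ⟨h2, h3, h4⟩ | ⟨h2, h3, h4⟩ | ⟨h2, h3, h4⟩
  · rw [bvec_apply_of_rank o v 2 h2 (rank2 o h0 h1) (by norm_num),
      bvec_apply_of_rank o v 3 h3 (rank3_of_mem2 o h0 h1 h2) (by norm_num), (bvec_eq_zero_iff o v 4).mpr h4]
    cases v.testBit 2 <;> cases v.testBit 3 <;> simp [sgn]
  · rw [bvec_apply_of_rank o v 2 h2 (rank2 o h0 h1) (by norm_num), (bvec_eq_zero_iff o v 3).mpr h3,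
      bvec_apply_of_rank o v 4 h4 (rank4 o h0 h1 (Or.inl ⟨h2, h3⟩)) (by norm_num)]
    cases v.testBit 2 <;> cases v.testBit 3 <;> simp [sgn]
  · rw [(bvec_eq_zero_iff o v 2).mpr h2, bvec_apply_of_rank o v 3 h3 (rank3_of_not2 o h0 h1 h2) (by norm_num),
      bvec_apply_of_rank o v 4 h4 (rank4 o h0 h1 (Or.inr ⟨h2, h3⟩)) (by norm_num)]
    cases v.testBit 2 <;> cases v.testBit 3 <;> simp [sgn]

/-- The condition on shape `B`, as a disjoint union of two products. -/
theorem cond_bvec_iff (J0 : Finset (Fin 24)) (o : Fin 759) (v : ℕ) :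
    ((((bvec o v) 0 = 2 ∧ (bvec o v) 1 = 2) ∧ (bvec o v) 2 + (bvec o v) 3 + (bvec o v) 4 = 0) ∧
        ∀ j ∈ J0, (bvec o v) j = 0) ↔
      (((((0 : Fin 24) ∈ osupp o ∧ (1 : Fin 24) ∈ osupp o) ∧
          ((2 : Fin 24) ∉ osupp o ∧ (3 : Fin 24) ∉ osupp o ∧ (4 : Fin 24) ∉ osupp o)) ∧ ∀ j ∈ J0, j ∉ osupp o) ∧
        (v.testBit 0 = false ∧ v.testBit 1 = false)) ∨
      (((((0 : Fin 24) ∈ osupp o ∧ (1 : Fin 24) ∈ osupp o) ∧ twoOfT o) ∧ ∀ j ∈ J0, j ∉ osupp o) ∧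
        (v.testBit 0 = false ∧ v.testBit 1 = false ∧ v.testBit 2 ≠ v.testBit 3)) := by
  -- `y₀ = y₁ = 2` on shape `B` (= `PrefixThird.bvec_01_iff`, not importable yet)
  have h01iff : (bvec o v 0 = 2 ∧ bvec o v 1 = 2) ↔
      ((0 : Fin 24) ∈ osupp o ∧ (1 : Fin 24) ∈ osupp o) ∧ (v.testBit 0 = false ∧ v.testBit 1 = false) := by
    rw [← bvec_nbr_iff, ip_x0]
    constructor
    · rintro ⟨e0, e1⟩; omega
    · intro h
      rcases bvec_apply_cases o v 0 with ⟨-, e0⟩ | ⟨-, e0 | e0⟩ <;>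
        rcases bvec_apply_cases o v 1 with ⟨-, e1⟩ | ⟨-, e1 | e1⟩ <;> omega
  rw [h01iff]
  have hJ : (∀ j ∈ J0, bvec o v j = 0) ↔ ∀ j ∈ J0, j ∉ osupp o :=
    ⟨fun h j hj => (bvec_eq_zero_iff o v j).mp (h j hj), fun h j hj => (bvec_eq_zero_iff o v j).mpr (h j hj)⟩
  rw [hJ]
  constructor
  · rintro ⟨⟨⟨h01, hv⟩, hsum⟩, hJ0⟩
    rcases bvec_apply_cases o v 2 with ⟨m2, e2⟩ | ⟨m2, e2 | e2⟩ <;>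
      rcases bvec_apply_cases o v 3 with ⟨m3, e3⟩ | ⟨m3, e3 | e3⟩ <;>
      rcases bvec_apply_cases o v 4 with ⟨m4, e4⟩ | ⟨m4, e4 | e4⟩ <;>
      first
        | exact Or.inl ⟨⟨⟨h01, m2, m3, m4⟩, hJ0⟩, hv⟩
        | (exfalso; omega)
        | (have ht : twoOfT o := by
             first
               | exact Or.inl ⟨m2, m3, m4⟩
               | exact Or.inr (Or.inl ⟨m2, m3, m4⟩)
               | exact Or.inr (Or.inr ⟨m2, m3, m4⟩)
           exact Or.inr ⟨⟨⟨h01, ht⟩, hJ0⟩, hv.1, hv.2, (sum_iff_of_twoOfT o v h01.1 h01.2 ht).mp hsum⟩)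
  · rintro (⟨⟨⟨h01, m2, m3, m4⟩, hJ0⟩, hv⟩ | ⟨⟨⟨h01, ht⟩, hJ0⟩, hv0, hv1, h23⟩)
    · refine ⟨⟨⟨h01, hv⟩, ?_⟩, hJ0⟩
      rw [(bvec_eq_zero_iff o v 2).mpr m2, (bvec_eq_zero_iff o v 3).mpr m3, (bvec_eq_zero_iff o v 4).mpr m4]; rfl
    · exact ⟨⟨⟨h01, hv0, hv1⟩, (sum_iff_of_twoOfT o v h01.1 h01.2 ht).mpr h23⟩, hJ0⟩

set_option maxRecDepth 100000 in
/-- `16` sign patterns are `+, +` at the positions `0, 1` and opposite at `2, 3` (right-bracketed form). -/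
theorem card_patterns_00_2ne3 :
    ((range 128).filter fun v => v.testBit 0 = false ∧ v.testBit 1 = false ∧ v.testBit 2 ≠ v.testBit 3).card = 16 := by
  decide +kernel

/-- `32 · K₀ + 16 · K₂` shape-`B` vectors satisfy the condition. -/
theorem card_B (J0 : Finset (Fin 24)) {K0 K2 : ℕ}
    (hK0 : (univ.filter fun o : Fin 759 => (((0 : Fin 24) ∈ osupp o ∧ (1 : Fin 24) ∈ osupp o) ∧
      ((2 : Fin 24) ∉ osupp o ∧ (3 : Fin 24) ∉ osupp o ∧ (4 : Fin 24) ∉ osupp o)) ∧ ∀ j ∈ J0, j ∉ osupp o).card = K0)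
    (hK2 : (univ.filter fun o : Fin 759 => (((0 : Fin 24) ∈ osupp o ∧ (1 : Fin 24) ∈ osupp o) ∧ twoOfT o) ∧ ∀ j ∈ J0, j ∉ osupp o).card = K2) :
    ((univ ×ˢ range 128).filter fun p : Fin 759 × ℕ =>
      ((((bvec p.1 p.2) 0 = 2 ∧ (bvec p.1 p.2) 1 = 2) ∧ (bvec p.1 p.2) 2 + (bvec p.1 p.2) 3 + (bvec p.1 p.2) 4 = 0) ∧
        ∀ j ∈ J0, (bvec p.1 p.2) j = 0)).card = 32 * K0 + 16 * K2 := by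
  rw [Finset.filter_congr (fun p _ => cond_bvec_iff J0 p.1 p.2), Finset.filter_or,
    Finset.card_union_of_disjoint]
  · rw [Finset.filter_product (fun o : Fin 759 => (((0 : Fin 24) ∈ osupp o ∧ (1 : Fin 24) ∈ osupp o) ∧
          ((2 : Fin 24) ∉ osupp o ∧ (3 : Fin 24) ∉ osupp o ∧ (4 : Fin 24) ∉ osupp o)) ∧ ∀ j ∈ J0, j ∉ osupp o)
        (fun v : ℕ => v.testBit 0 = false ∧ v.testBit 1 = false),
      Finset.filter_product (fun o : Fin 759 => (((0 : Fin 24) ∈ osupp o ∧ (1 : Fin 24) ∈ osupp o) ∧ twoOfT o) ∧ ∀ j ∈ J0, j ∉ osupp o)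
        (fun v : ℕ => v.testBit 0 = false ∧ v.testBit 1 = false ∧ v.testBit 2 ≠ v.testBit 3),
      card_product, card_product, hK0, hK2, card_patterns_00, card_patterns_00_2ne3]
    ring
  · rw [Finset.disjoint_filter]
    rintro p - ⟨⟨⟨-, h2⟩, -⟩, -⟩ ⟨⟨⟨-, ht⟩, -⟩, -⟩
    exact twoOfT_not_avoid _ ht h2

/-- **`|ST(J₀)| = 32 · K₀ + 16 · K₂`.** [cite: ConwaySloane1999, Ch. 4 §11 (135)] -/
theorem card_sec (J0 : Finset (Fin 24)) {K0 K2 : ℕ}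
    (hK0 : (univ.filter fun o : Fin 759 => (((0 : Fin 24) ∈ osupp o ∧ (1 : Fin 24) ∈ osupp o) ∧
      ((2 : Fin 24) ∉ osupp o ∧ (3 : Fin 24) ∉ osupp o ∧ (4 : Fin 24) ∉ osupp o)) ∧ ∀ j ∈ J0, j ∉ osupp o).card = K0)
    (hK2 : (univ.filter fun o : Fin 759 => (((0 : Fin 24) ∈ osupp o ∧ (1 : Fin 24) ∈ osupp o) ∧ twoOfT o) ∧ ∀ j ∈ J0, j ∉ osupp o).card = K2) :
    (sec J0).card = 32 * K0 + 16 * K2 := by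
  rw [sec, card_filter_leechInt (fun y => ((y 0 = 2 ∧ y 1 = 2) ∧ y 2 + y 3 + y 4 = 0) ∧ ∀ j ∈ J0, y j = 0) (card_A J0)
    (card_B J0 hK0 hK2) (card_C J0)]
  omega

/-- `y` with the coordinates `0, 1` set to `0` (integer, norm `24` on the sections). -/
def cut2 (y : Fin 24 → ℤ) : Fin 24 → ℤ := fun j => if j.val < 2 then 0 else y j

/-- Inner products after the cut. -/
theorem ip_cut2 (y y' : Fin 24 → ℤ) : ip (cut2 y) (cut2 y') = ip y y' - (y 0 * y' 0 + y 1 * y' 1) := by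
  simp [ip, cut2, Fin.sum_univ_succ]

/-- `cut2` is injective on each section. -/
theorem cut2_injOn (J0 : Finset (Fin 24)) : Set.InjOn cut2 ↑(sec J0) := by
  intro y hy y' hy' h
  obtain ⟨_, ⟨⟨a0, a1⟩, -⟩, -⟩ := mem_sec (Finset.mem_coe.mp hy)
  obtain ⟨_, ⟨⟨b0, b1⟩, -⟩, -⟩ := mem_sec (Finset.mem_coe.mp hy')
  funext j
  by_cases hj : j.val < 2
  · have hv : j.val = 0 ∨ j.val = 1 := by omega
    rcases hv with hv | hv
    · rw [show j = 0 from Fin.ext hv]; omega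
    · rw [show j = 1 from Fin.ext hv]; omega
  · have := congrFun h j
    simpa [cut2, hj] using this

/-- The cut, normalised section (in `ℝ²⁴`). -/
noncomputable def pre (J0 : Finset (Fin 24)) : Finset (EuclideanSpace ℝ (Fin 24)) :=
  (sec J0).image fun y => toE 24 (cut2 y)

/-- `|pre J₀| = |ST(J₀)|`. -/
theorem card_pre (J0 : Finset (Fin 24)) : (pre J0).card = (sec J0).card := by
  rw [pre, card_image_of_injOn (fun y hy y' hy' h => cut2_injOn J0 hy hy' (toE_injective (by norm_num) h))]

/-- The cut vectors are unit vectors after scaling by `1/√24`. -/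
theorem norm_pre (J0 : Finset (Fin 24)) : ∀ x ∈ pre J0, ‖x‖ = 1 := by
  intro x hx
  obtain ⟨y, hy, rfl⟩ := mem_image.mp hx
  obtain ⟨hL, ⟨⟨h0, h1⟩, -⟩, -⟩ := mem_sec hy
  exact norm_toE (by norm_num) (by rw [ip_cut2, ip_self_of_mem hL, h0, h1]; norm_num)

/-- Distinct cut vectors have inner product `≤ 1/3`. -/
theorem inner_pre (J0 : Finset (Fin 24)) : ∀ x ∈ pre J0, ∀ x' ∈ pre J0, x ≠ x' → inner ℝ x x' ≤ 1 / 3 := by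
  intro x hx x' hx' hne
  obtain ⟨y, hy, rfl⟩ := mem_image.mp hx
  obtain ⟨y', hy', rfl⟩ := mem_image.mp hx'
  obtain ⟨hL, ⟨⟨h0, h1⟩, -⟩, -⟩ := mem_sec hy
  obtain ⟨hL', ⟨⟨h0', h1'⟩, -⟩, -⟩ := mem_sec hy'
  have hyy : y ≠ y' := fun h => hne (by rw [h])
  rw [inner_toE (by norm_num), ip_cut2, h0, h1, h0', h1', div_le_iff₀ (by norm_num)]
  have h16 : (ip y y' : ℝ) ≤ 16 := by exact_mod_cast ip_le_of_mem hL hL' hyy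
  push_cast
  linarith

/-- The coordinate vector `e_j` (integer coordinates). -/
def e (j : Fin 24) : Fin 24 → ℤ := fun i => if i = j then 1 else 0

/-- Testing against `e_j` reads off the coordinate. -/
theorem ip_e (j : Fin 24) (y : Fin 24 → ℤ) : ip (e j) y = y j := by
  simp [ip, e]

/-- The vector `e₂ + e₃ + e₄` (integer coordinates). -/
def e234 : Fin 24 → ℤ := fun i => if i = 2 ∨ i = 3 ∨ i = 4 then 1 else 0

/-- Testing against `e₂ + e₃ + e₄`. -/
theorem ip_e234 (y : Fin 24 → ℤ) : ip e234 y = y 2 + y 3 + y 4 := by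
  simp [ip, e234, Fin.sum_univ_succ, add_assoc]

/-- The vanishing set `{0, 1} ∪ J₀` of the cut vectors. -/
def zset (J0 : Finset (Fin 24)) : Finset (Fin 24) := (univ.filter fun j : Fin 24 => j.val < 2) ∪ J0

/-- The cut vectors vanish on `zset J₀`. -/
theorem cut2_apply_eq_zero {J0 : Finset (Fin 24)} {y : Fin 24 → ℤ} (hy : y ∈ sec J0) {j : Fin 24}
    (hj : j ∈ zset J0) : cut2 y j = 0 := by
  obtain ⟨_, -, hJ⟩ := mem_sec hy
  rcases Finset.mem_union.mp hj with h | h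
  · simp [cut2, (Finset.mem_filter.mp h).2]
  · by_cases h' : j.val < 2
    · simp [cut2, h']
    · simp [cut2, h', hJ j h]

/-- `y₂ + y₃ + y₄ = 0` survives the cut. -/
theorem ip_e234_cut2 {J0 : Finset (Fin 24)} {y : Fin 24 → ℤ} (hy : y ∈ sec J0) : ip e234 (cut2 y) = 0 := by
  obtain ⟨_, ⟨-, h234⟩, -⟩ := mem_sec hy
  rw [ip_e234]
  simp only [cut2, Fin.val_two, show (3 : Fin 24).val = 3 from rfl, show (4 : Fin 24).val = 4 from rfl]
  norm_num
  exact h234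

/-- The normals: `e₂ + e₃` first, then the coordinate vectors indexed by `zset J₀`. -/
noncomputable def normals (J0 : Finset (Fin 24)) {k : ℕ} (hk : (zset J0).card = k) :
    Fin (k + 1) → EuclideanSpace ℝ (Fin 24) :=
  Fin.cases (toE 24 e234) fun i => toE 24 (e ((zset J0).orderEmbOfFin hk i))

/-- The normals are pairwise orthogonal and nonzero (for `J₀` avoiding `2, 3, 4`), hence linearly independent. -/
theorem linearIndependent_normals (J0 : Finset (Fin 24)) (hJ : ∀ j ∈ J0, 5 ≤ j.val) {k : ℕ}
    (hk : (zset J0).card = k) : LinearIndependent ℝ (normals J0 hk) := by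
  have hz : ∀ i : Fin k, (2 : Fin 24) ≠ (zset J0).orderEmbOfFin hk i ∧ (3 : Fin 24) ≠ (zset J0).orderEmbOfFin hk i ∧
      (4 : Fin 24) ≠ (zset J0).orderEmbOfFin hk i := by
    intro i
    have hm := (zset J0).orderEmbOfFin_mem hk i
    have h : 5 ≤ ((zset J0).orderEmbOfFin hk i).val ∨ ((zset J0).orderEmbOfFin hk i).val < 2 := by
      rcases Finset.mem_union.mp hm with h | h
      · exact Or.inr (Finset.mem_filter.mp h).2
      · exact Or.inl (hJ _ h)
    refine ⟨?_, ?_, ?_⟩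
    · intro h2; rw [← h2] at h; revert h; decide
    · intro h3; rw [← h3] at h; revert h; decide
    · intro h4; rw [← h4] at h; revert h; decide
  apply linearIndependent_of_ne_zero_of_inner_eq_zero
  · intro i h0
    rcases Fin.eq_zero_or_eq_succ i with rfl | ⟨i', rfl⟩
    · have hi := inner_toE (q := 24) (by norm_num) e234 e234
      simp only [normals, Fin.cases_zero] at h0
      rw [h0, inner_zero_left, ip_e234] at hi
      norm_num [e234] at hi
    · have hi := inner_toE (q := 24) (by norm_num) (e ((zset J0).orderEmbOfFin hk i'))
        (e ((zset J0).orderEmbOfFin hk i'))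
      simp only [normals, Fin.cases_succ] at h0
      rw [h0, inner_zero_left, ip_e] at hi
      simp [e] at hi
  · intro i j hij
    rcases Fin.eq_zero_or_eq_succ i with rfl | ⟨i', rfl⟩ <;>
      rcases Fin.eq_zero_or_eq_succ j with rfl | ⟨j', rfl⟩
    · exact absurd rfl hij
    · simp only [normals, Fin.cases_zero, Fin.cases_succ]
      rw [inner_toE (by norm_num), ip_e234]
      obtain ⟨h2, h3, h4⟩ := hz j'
      simp [e, h2, h3, h4]
    · simp only [normals, Fin.cases_zero, Fin.cases_succ]
      rw [inner_toE (by norm_num), ip_e]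
      obtain ⟨h2, h3, h4⟩ := hz i'
      simp [e234, Ne.symm h2, Ne.symm h3, Ne.symm h4]
    · simp only [normals, Fin.cases_succ]
      rw [inner_toE (by norm_num), ip_e]
      have hne : (zset J0).orderEmbOfFin hk i' ≠ (zset J0).orderEmbOfFin hk j' := by
        intro h; exact hij (by rw [((zset J0).orderEmbOfFin hk).injective h])
      simp [e, hne]

/-- The cut vectors are orthogonal to the normals. -/
theorem orth_pre (J0 : Finset (Fin 24)) {k : ℕ} (hk : (zset J0).card = k) :
    ∀ x ∈ pre J0, ∀ i, inner ℝ (normals J0 hk i) x = 0 := by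
  intro x hx i
  obtain ⟨y, hy, rfl⟩ := mem_image.mp hx
  refine Fin.cases ?_ (fun i => ?_) i
  · simp only [normals, Fin.cases_zero]
    rw [inner_toE (by norm_num), ip_e234_cut2 hy]
    simp
  · simp only [normals, Fin.cases_succ]
    rw [inner_toE (by norm_num), ip_e, cut2_apply_eq_zero hy ((zset J0).orderEmbOfFin_mem hk i)]
    simp

/-- **Generic row.** If `K₀` octads contain `0, 1` and avoid `{2, 3, 4} ∪ J₀`, `K₂` octads contain `0, 1` and exactly two
of `2, 3, 4` and avoid `J₀` (`J₀ ⊆ {5, …, 23}`), and `n + |{0,1} ∪ J₀| + 1 = 24`, then there are `32 K₀ + 16 K₂` unit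
vectors in `ℝⁿ` with pairwise inner products `≤ 1/3`. [cite: ConwaySloane1999, Ch. 4 §11 (135)] -/
theorem exists_code_third_triple_of_octads (J0 : Finset (Fin 24)) (hJ : ∀ j ∈ J0, 5 ≤ j.val) {K0 K2 k n : ℕ}
    (hK0 : (univ.filter fun o : Fin 759 => (((0 : Fin 24) ∈ osupp o ∧ (1 : Fin 24) ∈ osupp o) ∧
      ((2 : Fin 24) ∉ osupp o ∧ (3 : Fin 24) ∉ osupp o ∧ (4 : Fin 24) ∉ osupp o)) ∧ ∀ j ∈ J0, j ∉ osupp o).card = K0)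
    (hK2 : (univ.filter fun o : Fin 759 => (((0 : Fin 24) ∈ osupp o ∧ (1 : Fin 24) ∈ osupp o) ∧ twoOfT o) ∧ ∀ j ∈ J0, j ∉ osupp o).card = K2)
    (hk : (zset J0).card = k) (hn : n + (k + 1) = 24) :
    ∃ C : Finset (EuclideanSpace ℝ (Fin n)),
      C.card = 32 * K0 + 16 * K2 ∧ (∀ x ∈ C, ‖x‖ = 1) ∧ (∀ x ∈ C, ∀ y ∈ C, x ≠ y → inner ℝ x y ≤ 1 / 3) := by
  obtain ⟨C', hc, hn', hi, _⟩ := exists_transfer_orthogonal (m := 24) (n := n) (k := k + 1) (by omega) _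
    (linearIndependent_normals J0 hJ hk) (pre J0) (orth_pre J0 hk)
  refine ⟨C', by rw [hc, card_pre, card_sec J0 hK0 hK2], fun x' hx' => ?_, fun x' hx' y' hy' hne => ?_⟩
  · obtain ⟨x, hx, he⟩ := hn' x' hx'
    rw [he]; exact norm_pre J0 x hx
  · obtain ⟨x, hx, y, hy, hxy, he⟩ := hi x' hx' y' hy' hne
    rw [he]; exact inner_pre J0 x hx y hy hxy

set_option maxRecDepth 100000 in
set_option maxHeartbeats 1000000 in
/-- **`A(18, arccos 1/3) ≥ 704`**: `J₀ = {13, 15, 20}` (`{0, 1, 2, 3, 4, 13, 15, 20}` is an octad), `K₀ = 16`, `K₂ = 12`,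
`32·16 + 16·12 = 704`. [cite: ConwaySloane1999, Ch. 4 §11 (135)] -/
theorem exists_code_dim18_third_704 : ∃ C : Finset (EuclideanSpace ℝ (Fin 18)),
    C.card = 704 ∧ (∀ x ∈ C, ‖x‖ = 1) ∧ (∀ x ∈ C, ∀ y ∈ C, x ≠ y → inner ℝ x y ≤ 1 / 3) :=
  exists_code_third_triple_of_octads {13, 15, 20} (by decide) (K0 := 16) (K2 := 12) (by decide +kernel)
    (by decide +kernel) (k := 5) (by decide +kernel) rfl
end Summit.Ventures.PackingBounds.Config.Leech.PrefixThirdTriple
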